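/-
Copyright (c) 2026 the pub-hodgecm-mathlib formalisation cell (harness21).  Prover seat hodgecm-mathlib-R90-C133-p02 (g3), Track B ∕ K2-LIT ∕ R90-TF section S5
(Rogawski Ch. 13.3 ∕ §14.6); sequel of the (H30) census (§4 «(β)'s rows»): the (β) letter of the `₃` road modulo TWO rows — the row `hDiscXi` is STRUCK.
-/
import Summits.HodgeConjecture.HodgeConjecture.Theorems.R90S5EvpTransportAe      -- ★ p864229 (R90-C133-p01 (g2)): (T2) and its imports — ★ p864086 `ae_liftsTo_of_mem_occ`, ★ (ℓ-sphA) `SphXiHOneDimLaw.eq_xiH_of_sph_mem_ofChar`, ★ W1 `rhoXiU`∕`eq_rhoXiU_of_isCharPacket`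
import Summits.HodgeConjecture.HodgeConjecture.Theorems.R90S5OccGOfRecord         -- ★ p864324 (R90-C133-p03 (g3)): `R90.S5.OccGOfRecord L ι μ π c`, ★ `archDegOneClass`
import HarnessLib

/-!
# R90-TF · S5 — `R90S5QsArchJExhaustionTwoRows`: the (β) letter «ARCH-J EXHAUSTION ON THE QUASI-SPLIT GROUP, A.E. FORM» modulo TWO rows `h1336cArch` ∕ `hSph` —
# the third row `hDiscXi` of ★ p864086 ∕ ★ p864229 (T2) ∕ ★ p864792 is NOT NEEDED (Rogawski 1990, Thm. 13.3.6 (c) at `ι`; §13.1 p. 199 ¶2; Prop. 13.1.3 (d))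

Cell `hodgecm-mathlib`, crux H413 = `stmt-HodgeConjecture-24833`, route `HCCMUnconditional`; R90-TF section S5 (R90-C133); self-start after deal (H30)/(H30b) of the
S5 dealer R90-C133-plan (g3) (census `R90/R90-C133-p02/g3/CENSUS-254-RECORD-DATA.md` 49ee7375c870482b, §4 «(β)'s rows»).  PROOF lane (`--kind proof --supports
stmt-HodgeConjecture-24833 --as helper`): theorems only — no `def`, no `instance`, no notation, no named fact, no `sorry`; ★-only imports (no `Lines`, L9).

WHAT.  ★ p864086 `ae_liftsTo_of_mem_occ` (and after it ★ p864229 (T2) `exists_ae_liftsTo_rhoXiU_of_mem_occ`, ★ p864792 at the record occurrence predicate) derive the a.e.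
lift `∀ᶠ v, Q_v = ξ_H((rhoXiU h8U ξ′)_v)` of a `G`-packet with an occurring `[J^δ]`-member from THREE rows: `h1336cArch` (Thm. 13.3.6 (c) at `ι`: the member lies place by
place in `ξ_H(σ_v)` for a CHARACTER packet `σ` of some one-dimensional `ξ′`), `hSph` ((ℓ-sphA): a packet whose unramified member lies in `ξ_H({ξ_v})` IS it) and `hDiscXi`
(«the character packet of `ξ′` underlies a SPECTRAL `H`-packet `ρ`» — used only to produce an `IsOneDimH ρ` and then read back `ρ.fin = rhoXiU h8U ξ′` through ★ W3
`isOneDimH_iff_exists_fin_eq_rhoXiU`).  The detour through `ρ` is unnecessary: ★ W1 `GlobalPacketH.eq_rhoXiU_of_isCharPacket h8U ξ′` identifies the character packet `σ`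
with `rhoXiU h8U ξ′` DIRECTLY ((ℓ8ᵁ) uniqueness of the one-dimensional singleton `H_v`-packets), so the a.e. lift follows from `h1336cArch` + `hSph` alone.  Since
`hDiscXi` at the record frame costs C2 ED. 2b `packetHOfOneDimU … h8U hunrU ξ′` — i.e. the ABSENT row `hunrU` a second time (census §1 row 11, §4) — striking it removes
one open binder from the Index-edition payer of A :254 `stub_R90_1336c_membership₃`.
* §1 (kit-generic, opaque occurrence predicate `Occ`, trigger class `j`, as ★ p864086): the FILE-PRIVATE engine `eventually_loc_eq_xiH_rhoXiU_of_mem_occ_of_two_rows`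
  (= ★ p864229 (T2) `exists_ae_liftsTo_rhoXiU_of_mem_occ` WITHOUT its `hDiscXi` binder — a strictly stronger statement; kept `private` because the gate's dedup keys on
  conclusions, not hypotheses, and would read it as a restatement of (T2); consumers use §2, or re-derive the eight proof lines at their own `Occ`).
* §2 (record reading at `Occ := R90.S5.OccGOfRecord L ι μqs`, `j := archDegOneClass δ hδ`, `H′ := splitForm L 3`, over ★ `HomogPacketG` — the carrier of C's
  `PacketGOfRecord`): `forall_homog_eventually_loc_eq_xiH_rhoXiU_of_mem_occGOfRecord₂` = the BODY of (β) `QsArchJExhaustionLetter₃At L ι 𝔩 h8U 𝔞 μqs Pk` token for token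
  (generic `infOf`∕`aTok`), so the Lines-side payer is ONE `exact`; rows {`h1336cArch` [D ED. 5 `archRow_h1336c_of_record`], `hSph` [S4-A :1119 + JQ-S5→S4-13 split twin]}.
HONEST LABEL: a specialisation with fewer rows pays no socket — the two rows are INPUTS (D-side ∕ S4); S5 ON-PATH code-sorries unchanged; HC_CM is proved only modulo the
7 printed citations (2 remaining named inputs: hLiu418 = stmt-HodgeConjecture-24832, h413 = stmt-HodgeConjecture-24833) until rung 0 closes.

## References
* [Rogawski1990] J. D. Rogawski, *Automorphic Representations of Unitary Groups in Three Variables*, Ann. of Math. Stud. 123 (1990): §13.3 Thm. 13.3.3 (c), Thm. 13.3.6 (c)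
  p. 202, p. 201 ll. 10–18; §13.10 p. 230; §13.1 p. 199 ¶2, Prop. 13.1.3 (d); §12.1 p. 171; §12.3 p. 178; §14.6 Prop. 14.6.2 pp. 242–243.
-/

set_option autoImplicit false
set_option linter.dupNamespace false -- the mandated namespace repeats `HodgeConjecture.HodgeConjecture`, as in every sibling `R90S5*` file

noncomputable section

open NumberField IsDedekindDomain MeasureTheory Filter
open scoped Matrix
open Literature.NumberTheory Literature.NumberTheory.Automorphic Literature.NumberTheory.Automorphic.UnitaryGroup
open Literature.NumberTheory.Rogawski1990 Literature.NumberTheory.GaloisRepresentations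
open Literature.RepresentationTheory Literature.RepresentationTheory.BorelWallach2000 Literature.RepresentationTheory.KonnoKonno2007

namespace Summit.HodgeConjecture.HodgeConjecture.R90.S5

open Summit.HodgeConjecture.HodgeConjecture.Cruxes.H413
open Summit.HodgeConjecture.HodgeConjecture.Cruxes.H413.F0P3LocalPacketKit
open Summit.HodgeConjecture.HodgeConjecture.Cruxes.H413.F0P3GlobalPacket
open Summit.HodgeConjecture.HodgeConjecture.Cruxes.H413.F0P3GlobalPacketDiscrete
open Summit.HodgeConjecture.HodgeConjecture.Cruxes.H413.F0P3ArchPacketKit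
open Summit.HodgeConjecture.HodgeConjecture.Cruxes.H413.F0P3SpectralPacket
open Summit.HodgeConjecture.HodgeConjecture.Cruxes.H413.F0P3InnerFormClassificationV6 (splitForm)
open Summit.HodgeConjecture.HodgeConjecture.Cruxes.H413.F0P3bArchDegOneClass (archDegOneClass)

/-! ## §1 Kit-generic: the a.e. lift from TWO rows (opaque occurrence predicate) -/

section Generic

variable (L : Type) [Field L] [NumberField L] [IsCMField L] {H' : Matrix (Fin 3) (Fin 3) L}
  {𝔩 : ∀ v : HeightOneSpectrum (𝓞 ↥(maximalRealSubfield L)), LocalPacketKit L H' v} {𝔞 : ArchPacketKit}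
  {μ : Measure (adelicGroupData (↥(maximalRealSubfield L)) L (IsCMField.complexConj L) 3 H').automorphicQuotient}
  [SMulInvariantMeasure (adelicGroupData (↥(maximalRealSubfield L)) L (IsCMField.complexConj L) 3 H').Adelic
    (adelicGroupData (↥(maximalRealSubfield L)) L (IsCMField.complexConj L) 3 H').automorphicQuotient μ]
  (Occ : (∀ v : HeightOneSpectrum (𝓞 ↥(maximalRealSubfield L)), IrrClass ((cmDatum L 3 H').Local v)) → GKIrrClass (uFormGroup (Fin 2) (Fin 1)) → Prop)
  (j : GKIrrClass (uFormGroup (Fin 2) (Fin 1)))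
  (h1336cArch : ∀ π : ∀ v : HeightOneSpectrum (𝓞 ↥(maximalRealSubfield L)), IrrClass ((cmDatum L 3 H').Local v), Occ π j →
    ∃ σ : GlobalPacketH 𝔩, (∃ ξ' : OneDimAutRepH L, σ.IsCharPacket (fun v => ξ'.xiLocalChar v) (fun v => F0P3XiLocalCharOpenKernel.isOpen_ker_xiLocalChar L ξ' v)) ∧
      ∀ v : HeightOneSpectrum (𝓞 ↥(maximalRealSubfield L)), π v ∈ (𝔩 v).mem ((𝔩 v).xiH (σ.loc v)))
  (hSph : ∀ v : HeightOneSpectrum (𝓞 ↥(maximalRealSubfield L)), (𝔩 v).SphXiHOneDimLaw)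
  (h8U : ∀ v : HeightOneSpectrum (𝓞 ↥(maximalRealSubfield L)), (𝔩 v).OneDimHLawU)

include h1336cArch hSph

/-- **THE a.e. LIFT FROM TWO ROWS** (kit-generic; file-private engine of §2; ★ p864086's argument with the `SpectralPacketH` detour removed): a discrete `G`-packet `Q` with a member tuple `π ∈ Q_f`
OCCURRING with the trigger class `j` (`Occ π j`) satisfies `Q_v = ξ_H((rhoXiU h8U ξ′)_v)` for almost all finite `v`, for SOME one-dimensional automorphic `ξ′` — from
`h1336cArch` [Thm. 13.3.6 (c) at `ι`: `π` lies placewise in `ξ_H(σ_v)` for a character packet `σ` of some `ξ′`] and `hSph` [(ℓ-sphA): the unramified member pins the packet]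
ONLY; the character packet IS `rhoXiU h8U ξ′` by ★ W1 `eq_rhoXiU_of_isCharPacket` ((ℓ8ᵁ) uniqueness), so no «`σ` underlies a spectral `H`-packet» row is consumed.
[cite: Rogawski1990, §13.3 Thm. 13.3.6 (c) p. 202, p. 201 ll. 10–18; §13.10 p. 230; §13.1 p. 199 ¶2, Prop. 13.1.3 (d); §12.1 p. 171] -/
private theorem eventually_loc_eq_xiH_rhoXiU_of_mem_occ_of_two_rows (Q : SpectralPacketG 𝔩 𝔞 μ)
    (hOcc : ∃ π : ∀ v : HeightOneSpectrum (𝓞 ↥(maximalRealSubfield L)), IrrClass ((cmDatum L 3 H').Local v), Q.fin.Mem π ∧ Occ π j) :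
    ∃ ξ : OneDimAutRepH L, ∀ᶠ v : HeightOneSpectrum (𝓞 ↥(maximalRealSubfield L)) in cofinite,
      Q.fin.loc v = (𝔩 v).xiH ((GlobalPacketH.rhoXiU h8U ξ).loc v) := by
  obtain ⟨π, hmem, hocc⟩ := hOcc
  -- Thm. 13.3.6 (c) at `ι`: the occurring member lies placewise in `ξ_H(σ_v)`, `σ` the character packet of some one-dimensional `ξ′`
  obtain ⟨σ, ⟨ξ', hσ⟩, hπσ⟩ := h1336cArch π hocc
  -- (ℓ8ᵁ) uniqueness: that character packet IS `rhoXiU h8U ξ′`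
  have hσeq : σ = GlobalPacketH.rhoXiU h8U ξ' := GlobalPacketH.eq_rhoXiU_of_isCharPacket h8U ξ' hσ
  refine ⟨ξ', ?_⟩
  -- a.e. `v`: `π v` is the unramified member of `Q_v` (★ `Mem`), and (ℓ-sphA) pins `Q_v = ξ_H(σ_v)`
  filter_upwards [hmem.2] with v hv
  obtain ⟨hunr, hπv⟩ := hv
  rw [← hσeq]
  refine (hSph v).eq_xiH_of_sph_mem_ofChar (Q.fin.loc v) hunr (σ.loc v) (ξ'.xiLocalChar v)
    (F0P3XiLocalCharOpenKernel.isOpen_ker_xiLocalChar L ξ' v) (hσ v) ?_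
  rw [← hπv]
  exact hπσ v

end Generic

/-! ## §2 At the record occurrence predicate ★ `OccGOfRecord L ι μqs · (archDegOneClass δ hδ)` on `U(Φ₃)` (★ p864792's binders MINUS `hDiscXi`) -/

section AtRecord

variable (L : Type) [Field L] [NumberField L] [IsCMField L] (ι : L →+* ℂ)
  {𝔩 : ∀ v : HeightOneSpectrum (𝓞 ↥(maximalRealSubfield L)), LocalPacketKit L (splitForm L 3) v} {𝔞 : ArchPacketKit}
  (μqs : Measure (adelicGroupData (↥(maximalRealSubfield L)) L (IsCMField.complexConj L) 3 (splitForm L 3)).automorphicQuotient)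
  [(adelicGroupData (↥(maximalRealSubfield L)) L (IsCMField.complexConj L) 3 (splitForm L 3)).IsAutomorphicMeasure μqs]
  (h1336cArch : ∀ (δ : ℤ) (hδ : δ = 1 ∨ δ = -1)
    (π : ∀ v : HeightOneSpectrum (𝓞 ↥(maximalRealSubfield L)), IrrClass ((cmDatum L 3 (splitForm L 3)).Local v)),
    OccGOfRecord L ι μqs π (archDegOneClass δ hδ) →
      ∃ σ : GlobalPacketH 𝔩,
        (∃ ξ' : OneDimAutRepH L, σ.IsCharPacket (fun v => ξ'.xiLocalChar v) (fun v => F0P3XiLocalCharOpenKernel.isOpen_ker_xiLocalChar L ξ' v)) ∧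
          ∀ v : HeightOneSpectrum (𝓞 ↥(maximalRealSubfield L)), π v ∈ (𝔩 v).mem ((𝔩 v).xiH (σ.loc v)))
  (hSph : ∀ v : HeightOneSpectrum (𝓞 ↥(maximalRealSubfield L)), (𝔩 v).SphXiHOneDimLaw)
  (h8U : ∀ v : HeightOneSpectrum (𝓞 ↥(maximalRealSubfield L)), (𝔩 v).OneDimHLawU)

include h1336cArch hSph

/-- **THE (β) LETTER AT THE RECORD FRAME, BY VALUE, MODULO TWO ROWS — IN THE EXACT BINDER SHAPE OF S5-A3's `QsArchJExhaustionLetter₃At L ι 𝔩 h8U 𝔞 μqs Pk`**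
(whose packets `Q : PacketGOfRecord 𝔩 𝔞 μqs Pk` ARE ★ `SpectralPacketG.HomogPacketG 𝔩 𝔞 μqs (infOfOfRecord …) (aTokOfRecord 𝔩 Pk)` — here generic in `infOf`, `aTok`):
for every sign `δ = ±1`, a coherent homogeneous discrete `G`-packet `Q` one of whose member families OCCURS on `U(Φ₃)` through a discrete `P′` carrying a coh-unitary token of
class `[J^δ]` at `ι` (★ `OccGOfRecord`) satisfies `Q_v = ξ_H((rhoXiU h8U ξ′)_v)` for almost all finite `v`, for SOME one-dimensional automorphic `ξ′` — given ONLY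
`h1336cArch` [13.3.6 (c) at `ι`; D ED. 5 `archRow_h1336c_of_record`] and `hSph` [(ℓ-sphA); S4-A :1119 non-split + JQ-S5→S4-13 split twin]; ★ p864792's third row `hDiscXi`
is STRUCK (§1).  The Lines-side payer of (β) is now `exact forall_homog_eventually_loc_eq_xiH_rhoXiU_of_mem_occGOfRecord₂ L ι μqs h1336cArch hSph h8U` (no wrapper).
No 13.3.5; `Q` read through `Q.1.fin` only. [cite: Rogawski1990, §13.3 Thm. 13.3.6 (c) p. 202, p. 201 ll. 10–18; §13.10 p. 230; §13.1 p. 199 ¶2, Prop. 13.1.3 (d); §12.3 p. 178] -/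
theorem forall_homog_eventually_loc_eq_xiH_rhoXiU_of_mem_occGOfRecord₂ {infOf : GlobalPacket 𝔩 → 𝔞.PktInf}
    {aTok : ∀ v : HeightOneSpectrum (𝓞 ↥(maximalRealSubfield L)), Set (𝔩 v).Pkt} :
    ∀ (Q : SpectralPacketG.HomogPacketG 𝔩 𝔞 μqs infOf aTok) (δ : ℤ) (hδ : δ = 1 ∨ δ = -1),
      (∃ π : ∀ v : HeightOneSpectrum (𝓞 ↥(maximalRealSubfield L)), IrrClass ((cmDatum L 3 (splitForm L 3)).Local v),
          Q.1.fin.Mem π ∧ OccGOfRecord L ι μqs π (archDegOneClass δ hδ)) →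
        ∃ ξ' : OneDimAutRepH L, ∀ᶠ v : HeightOneSpectrum (𝓞 ↥(maximalRealSubfield L)) in cofinite,
          Q.1.fin.loc v = (𝔩 v).xiH ((GlobalPacketH.rhoXiU h8U ξ').loc v) :=
  fun Q δ hδ hOcc =>
    eventually_loc_eq_xiH_rhoXiU_of_mem_occ_of_two_rows L (OccGOfRecord L ι μqs) (archDegOneClass δ hδ) (h1336cArch δ hδ) hSph h8U Q.1 hOcc

end AtRecord

end Summit.HodgeConjecture.HodgeConjecture.R90.S5

end
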